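import Mathlib
import HarnessLib
import Summits.ResolutionOfSingularities.ResolutionOfSingularities.Theorems.WildQuotientsWildQuotientResolutionS1aA1Move2Cover
import Summits.ResolutionOfSingularities.ResolutionOfSingularities.Theorems.WildQuotientsWildQuotientResolutionS1aD4Move2Ring

/-!
# S1a — INSTANCE I-3 (D₄), ring level, MOVE 2: the σ-fixed cover `(z′^{dbar·d₂}, (X₀′^{dp}·η⁻¹)^{2d₂})` of `B₊(z′, X₀′)`, `hrad`, degrees

[OURS · L1 W4.5c · lead-1 g13; plan-1 RULING R-F15e, X-CERT v1.1 §2 / v1.2-D4ROWS move 2 «[X₀′] KILLED, [z] RESIDUAL», NOTES `D4 TREE OF RECORD`; pattern of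
✓`…S1aA1Move2Cover`] — NOT statements of the manuscript; counted 0; AI-level work, weaker than expert review. Crux stmt-ResolutionOfSingularities-17941
`CyclicQuotientFourfolds`, line `s1a-logminvertex` v13 (`stub_reachLowerInFX`).

Abstract setting of ✓`…S1aD4Move2Ring`: `P` (model of `N(x₁)` after the recoordination `z′ = x₂ − sX₁′`) with `τ`, the `τ`-FIXED centre `(z, X₀)` of weights
`(1, 1)`, and a `τ`-fixed unit `η` with inverse `ηinv` (the inverted norm); `dbar = d(2p)`. Both centre generators being fixed, NO norms are needed:
* cover `d4m2_cover_zero_mem/_fixed/_deg` (`y₀ = z^{d₂·dbar}`), `d4m2_cover_one_mem/_fixed/_deg` (`y₁ = (X₀^{dp}·ηinv)^{2d₂}`), `d4m2_hf` (degrees `(0, 2θ)`),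
  `d4m2_coverElement_one_eq` (`c₁ = (X₀T)^{2dpd₂}·ηinv^{2d₂}`);
* ★ `d4m2_hrad` — `zT, X₀T ∈ √(c₀, c₁)`.
-/

set_option linter.dupNamespace false

noncomputable section

open Literature.AlgebraicGeometry.Resolution
open scoped LaurentPolynomial
open Summit.ResolutionOfSingularities.ResolutionOfSingularities.Theorems.WildQuotientResolution.S1.CoarseChart
open Summit.ResolutionOfSingularities.ResolutionOfSingularities.Theorems.WildQuotientResolution.S1.BlowupCharts
open Summit.ResolutionOfSingularities.ResolutionOfSingularities.Theorems.WildQuotientResolution.S1.ReesBigrading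

namespace Summit.ResolutionOfSingularities.ResolutionOfSingularities.Theorems.WildQuotientResolution.S1.KillCert.D4

variable {P : Type} [CommRing P] (τ : P ≃+* P) (z X₀ η ηinv : P)
  (hz : τ z = z) (hX₀ : τ X₀ = X₀) (hηinv : τ ηinv = ηinv) (hηη : η * ηinv = 1) {p : ℕ} (d d₂ : ℕ)

/-! ## The cover -/

/-- **Cover element 0** of move 2: `y₀ = z^{d₂·dbar} ∈ 𝒥_{d₂·dbar}`. -/
theorem d4m2_cover_zero_mem : z ^ (d₂ * (d * (2 * p))) ∈ (weightedFiltration (![z, X₀] : Fin 2 → P) ![1, 1]).ideal (d₂ * (d * (2 * p))) := by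
  have h := Ideal.pow_mem_pow (mem_weightedFiltration_ideal (![z, X₀] : Fin 2 → P) ![1, 1] 0) (d₂ * (d * (2 * p)))
  have hle := Veronese.idealFiltration_pow_le (weightedFiltration (![z, X₀] : Fin 2 → P) ![1, 1]) 1 (d₂ * (d * (2 * p)))
  rw [one_mul] at hle
  exact hle h

/-- **Cover element 1** of move 2: `y₁ = (X₀^{dp}·ηinv)^{2d₂} ∈ 𝒥_{d₂·dbar}`. -/
theorem d4m2_cover_one_mem : (X₀ ^ (d * p) * ηinv) ^ (2 * d₂) ∈ (weightedFiltration (![z, X₀] : Fin 2 → P) ![1, 1]).ideal (d₂ * (d * (2 * p))) := by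
  have h0 : X₀ ^ (d * p) ∈ (weightedFiltration (![z, X₀] : Fin 2 → P) ![1, 1]).ideal (d * p) := by
    have h := Ideal.pow_mem_pow (mem_weightedFiltration_ideal (![z, X₀] : Fin 2 → P) ![1, 1] 1) (d * p)
    have hle := Veronese.idealFiltration_pow_le (weightedFiltration (![z, X₀] : Fin 2 → P) ![1, 1]) 1 (d * p)
    rw [one_mul] at hle
    exact hle h
  have h1 : X₀ ^ (d * p) * ηinv ∈ (weightedFiltration (![z, X₀] : Fin 2 → P) ![1, 1]).ideal (d * p) := Ideal.mul_mem_right _ _ h0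
  have h := Ideal.pow_mem_pow h1 (2 * d₂)
  have hle := Veronese.idealFiltration_pow_le (weightedFiltration (![z, X₀] : Fin 2 → P) ![1, 1]) (d * p) (2 * d₂)
  rw [show d * p * (2 * d₂) = d₂ * (d * (2 * p)) by ring] at hle
  exact hle h

include hz in
/-- `y₀` is `τ`-fixed. -/
theorem d4m2_cover_zero_fixed : τ (z ^ (d₂ * (d * (2 * p)))) = z ^ (d₂ * (d * (2 * p))) := by rw [map_pow, hz]

include hX₀ hηinv in
/-- `y₁` is `τ`-fixed. -/
theorem d4m2_cover_one_fixed : τ ((X₀ ^ (d * p) * ηinv) ^ (2 * d₂)) = (X₀ ^ (d * p) * ηinv) ^ (2 * d₂) := by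
  rw [map_pow, map_mul, map_pow, hX₀, hηinv]

/-- `c₁ = (X₀T)^{2dp·d₂}·ηinv^{2d₂}` for the move-2 cover element `c₁ = y₁T^{d₂·dbar}`. -/
theorem d4m2_coverElement_one_eq (c₁ : ↥(cobordantAlgebra (![z, X₀] : Fin 2 → P) ![1, 1]))
    (hc₁ : (c₁ : P[T;T⁻¹]) = LaurentPolynomial.C ((X₀ ^ (d * p) * ηinv) ^ (2 * d₂)) * LaurentPolynomial.T ((d₂ * (d * (2 * p)) : ℕ) : ℤ)) :
    c₁ = cobordantAlgebra.u' (![z, X₀] : Fin 2 → P) ![1, 1] 1 ^ (d * p * (2 * d₂)) * algebraMap P _ (ηinv ^ (2 * d₂)) := by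
  refine Subtype.ext ?_
  rw [hc₁, MulMemClass.coe_mul, SubmonoidClass.coe_pow, cobordantAlgebra.coe_u', cobordantAlgebra.coe_algebraMap]
  change _ = (LaurentPolynomial.C X₀ * LaurentPolynomial.T ((1 : ℕ) : ℤ)) ^ (d * p * (2 * d₂)) * LaurentPolynomial.C (ηinv ^ (2 * d₂))
  rw [mul_pow (LaurentPolynomial.C X₀), ← map_pow, LaurentPolynomial.T_pow, mul_right_comm, ← map_mul,
    show ((d * p * (2 * d₂) : ℕ) : ℤ) * ((1 : ℕ) : ℤ) = ((d₂ * (d * (2 * p)) : ℕ) : ℤ) by push_cast; ring]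
  congr 2
  rw [mul_pow, ← pow_mul]

include hηη in
/-- ★ **`hrad` for move 2 of MT-D₄**: `zT, X₀T ∈ √(y₀T^{d₂dbar}, y₁T^{d₂dbar})`. [OURS · L1 W4.5c · D₄ move 2] -/
theorem d4m2_hrad (c₀ c₁ : ↥(cobordantAlgebra (![z, X₀] : Fin 2 → P) ![1, 1]))
    (hc₀ : (c₀ : P[T;T⁻¹]) = LaurentPolynomial.C (z ^ (d₂ * (d * (2 * p)))) * LaurentPolynomial.T ((d₂ * (d * (2 * p)) : ℕ) : ℤ))
    (hc₁ : (c₁ : P[T;T⁻¹]) = LaurentPolynomial.C ((X₀ ^ (d * p) * ηinv) ^ (2 * d₂)) * LaurentPolynomial.T ((d₂ * (d * (2 * p)) : ℕ) : ℤ)) (i : Fin 2) :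
    cobordantAlgebra.u' (![z, X₀] : Fin 2 → P) ![1, 1] i ∈ (Ideal.span ({c₀, c₁} : Set ↥(cobordantAlgebra (![z, X₀] : Fin 2 → P) ![1, 1]))).radical := by
  have hZ0 : cobordantAlgebra.u' (![z, X₀] : Fin 2 → P) ![1, 1] 0 ^ (d₂ * (d * (2 * p))) = c₀ := by
    refine Subtype.ext ?_
    rw [SubmonoidClass.coe_pow, cobordantAlgebra.coe_u', hc₀]
    change (LaurentPolynomial.C z * LaurentPolynomial.T ((1 : ℕ) : ℤ)) ^ (d₂ * (d * (2 * p))) = _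
    rw [mul_pow, ← map_pow, LaurentPolynomial.T_pow, show ((d₂ * (d * (2 * p)) : ℕ) : ℤ) * ((1 : ℕ) : ℤ) = ((d₂ * (d * (2 * p)) : ℕ) : ℤ) by push_cast; ring]
  have hηp : ηinv ^ (2 * d₂) * η ^ (2 * d₂) = 1 := by rw [← mul_pow, mul_comm ηinv, hηη, one_pow]
  have hY0 : cobordantAlgebra.u' (![z, X₀] : Fin 2 → P) ![1, 1] 1 ^ (d * p * (2 * d₂)) = c₁ * algebraMap P _ (η ^ (2 * d₂)) := by
    rw [d4m2_coverElement_one_eq z X₀ ηinv d d₂ c₁ hc₁, mul_assoc (cobordantAlgebra.u' (![z, X₀] : Fin 2 → P) ![1, 1] 1 ^ (d * p * (2 * d₂))),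
      ← map_mul, hηp, map_one, mul_one]
  have hZrad : cobordantAlgebra.u' (![z, X₀] : Fin 2 → P) ![1, 1] 0 ∈ (Ideal.span ({c₀, c₁} : Set ↥(cobordantAlgebra (![z, X₀] : Fin 2 → P) ![1, 1]))).radical :=
    ⟨d₂ * (d * (2 * p)), by rw [hZ0]; exact Ideal.subset_span (by simp)⟩
  have hYrad : cobordantAlgebra.u' (![z, X₀] : Fin 2 → P) ![1, 1] 1 ∈ (Ideal.span ({c₀, c₁} : Set ↥(cobordantAlgebra (![z, X₀] : Fin 2 → P) ![1, 1]))).radical :=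
    ⟨d * p * (2 * d₂), by rw [hY0]; exact Ideal.mul_mem_right _ _ (Ideal.subset_span (by simp))⟩
  fin_cases i
  · exact hZrad
  · exact hYrad

/-! ## Degrees -/

section Degrees

variable {m : ℕ} (r : Fin m → ℕ) (𝒜 : (Π j : Fin m, ZMod (r j)) → AddSubgroup P) [GradedRing 𝒜] (θ : Π j : Fin m, ZMod (r j))
  (hzd : z ∈ 𝒜 0) (hX₀d : X₀ ∈ 𝒜 (2 • θ)) (hηinvd : ηinv ∈ 𝒜 (-((d * (2 * p)) • θ)))

omit [GradedRing 𝒜] in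
include hzd hX₀d in
/-- The centre `(z, X₀)` is homogeneous of degrees `(0, 2•θ)`. -/
theorem d4m2_hf (i : Fin 2) : (![z, X₀] : Fin 2 → P) i ∈ 𝒜 ((![0, 2 • θ] : Fin 2 → Π j : Fin m, ZMod (r j)) i) := by
  fin_cases i
  · exact hzd
  · exact hX₀d

include hzd in
/-- `y₀` has degree 0. -/
theorem d4m2_cover_zero_deg : z ^ (d₂ * (d * (2 * p))) ∈ 𝒜 0 := by
  have h := SetLike.pow_mem_graded (d₂ * (d * (2 * p))) hzd
  rwa [smul_zero] at h

include hX₀d hηinvd in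
/-- `y₁` has degree 0. -/
theorem d4m2_cover_one_deg : (X₀ ^ (d * p) * ηinv) ^ (2 * d₂) ∈ 𝒜 0 := by
  have h1 : X₀ ^ (d * p) * ηinv ∈ 𝒜 ((d * p) • (2 • θ) + -((d * (2 * p)) • θ)) := SetLike.mul_mem_graded (SetLike.pow_mem_graded _ hX₀d) hηinvd
  have e1 : (d * p) • (2 • θ) + -((d * (2 * p)) • θ) = 0 := by
    rw [← mul_nsmul', show d * p * 2 = d * (2 * p) by ring, add_neg_cancel]
  rw [e1] at h1
  have h := SetLike.pow_mem_graded (2 * d₂) h1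
  rwa [smul_zero] at h

end Degrees

end Summit.ResolutionOfSingularities.ResolutionOfSingularities.Theorems.WildQuotientResolution.S1.KillCert.D4

end
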